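import Summits.Ventures.AbcSig.Rows.Bridge
import Summits.Ventures.AbcSig.Rows.C2aL269A45S
import Summits.Ventures.AbcSig.Rows.C2aL269A45SAB

/-!
# Venture AbcSig — CELL `C2aL269A45`: the census statement `Rows.C2aCellRed 269 (fun a => a = 4 ∨ a = 5) ∅` from the two row theorems

S-VARIANT (p-lean g6 `gen6/spatch.py`) of `cell_C2aL269A45`: kernel sieve discharges replace the cited pair(s) 538.5 @ 13 (see the row files `Rows/C2aL269A45S.lean`, `Rows/C2aL269A45SAB.lean`).
HONEST FRAMING. COMPUTATION cell `pub-abcsig`; CONDITIONAL theorem; no claim on ABC or any summit. Hypotheses exactly as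
in `Rows/C2aL269A45.lean` and `Rows/C2aL269A45AB.lean`: `BS04Package` (CITED), `DataComplete …` (COMPUTED level files), and the
rows' per-orbit exclusions for BOTH family predicates (`famB`, `famAB`) as universally quantified hypotheses (CITED: the census
row's certificates). Conclusion = p1's census predicate (`Rows/Statements.lean`), all four coprime coefficient
distributions `A·B = 2^a·269^m`, reduced exponents `a < n`, `m < n` (RULING H1). GENERATED by p-lean g2 gen/make_rows.py
(after plean/make_cell_bridges.py).
-/

namespace Summit.Ventures.AbcSig

/-- Cell `C2aL269A45`: `Rows.C2aCellRed 269 (fun a => a = 4 ∨ a = 5) ∅` under the rows' hypotheses. -/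
theorem xcell_C2aL269A45S (M : NewformModel) (hP : M.BS04Package)
    (hD538 : M.DataComplete 538 level538Orbits)
    (hD2152 : M.DataComplete 2152 level2152Orbits)
    (hRB_orbit_538_5 : ∀ f : M.Form 538, M.Matches f orbit_538_5 → M.Matches f rb_538_5)
    (hX_orbit_2152_2 : ∀ n a m : ℕ, n ∈ ([7, 11] : List ℕ) → M.Excludes 2152 orbit_2152_2 (famB (2 ^ a * 269 ^ m) n (fun _ _ => True)))
    (hX_orbit_2152_2' : ∀ n a m : ℕ, n ∈ ([7, 11] : List ℕ) → M.Excludes 2152 orbit_2152_2 (famAB (269 ^ m) (2 ^ a) n (fun _ _ => True))) :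
    Rows.C2aCellRed 269 (fun a => a = 4 ∨ a = 5) ∅ :=
  C2aCellRed_of_rows 269 (by norm_num) (by norm_num) _ _
    (fun n hn h11 hnℓ _ a m ha han hm hmn x y z h1 h2 =>
      xrow_C2aL269A45S M hP hD538 hD2152 n hn h11 hnℓ a m ha hm han hmn hRB_orbit_538_5 (hX_orbit_2152_2 n a m) x y z h1 h2)
    (fun n hn h11 hnℓ _ a m ha han hm hmn x y z h1 h2 =>
      xrow_C2aL269A45SAB M hP hD538 hD2152 n hn h11 hnℓ a m ha hm han hmn hRB_orbit_538_5 (hX_orbit_2152_2' n a m) x y z h1 h2)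

end Summit.Ventures.AbcSig
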